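import Summits.CriticalPhenomena.PercolationContinuityZ3.Theorems.PercNearOneGluingNoHeavyLowerTailLossyPocketCoverKN
import Summits.CriticalPhenomena.PercolationContinuityZ3.Theorems.PercNearOneGluingNoHeavyLowerTailSignedStarTransfer
import HarnessLib

/-!
# `NoHeavyLowerTail` (stmt-CriticalPhenomena-4575) — the SIGNED glued-block transfer read INSIDE `Wᶜ`

Support file (engine seat `prim-cplus-engine` g5; `--supports stmt-CriticalPhenomena-4575`).  No definitions, no
named facts, no sorries.

* `LossyPocketT.blockSmall_signed_inside` — for relays `A` avoiding `W`, a block `N ⊆ A` with `v ∈ N` and a relay `c`: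
  `μ{c ↮ v inside Wᶜ}·(μ{port block j-small inside Wᶜ} − μ{c j-small in G[Wᶜ] + K_N}) ≤ (Φ_{Wᶜ}(v) − Φ_{Wᶜ}(c))·μ{c ↮ N inside Wᶜ}`.
  Transport (`LossyPocketT.real_inside_eq_real_restrict`) of the full-cluster signed transfer (`LossyPocketT.blockSmall_signed`
  of `…SignedBlockTransfer.lean`, p189986; re-proved here as a private local copy so that this module elaborates independently
  of that module's build), itself `SignedStar.lemma3_ii_signed` plus set algebra.  The per-state inequality of the signed
  quantitative cover `LLQ` (`…SignedPocketCover.lean`; engine memo `ENGINE-g5.md` §3).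
-/

noncomputable section

namespace Summit.CriticalPhenomena.PercolationContinuityZ3.Theorems

open MeasureTheory Set Literature.Probability.LatticeModels Literature.Probability.Percolation
open Literature.Probability.Percolation.KNPreFKG
open scoped Classical BigOperators

namespace LossyPocketT

variable {n : ℕ}

/-- Local copy of `LossyPocketT.blockSmall_signed` (`…SignedBlockTransfer.lean`, p189986) — inlined so that this file
elaborates independently of that module's farm build. **Signed glued-block transfer, full-cluster form.**  For any weights, a block `N ∋ v` and a vertex `c`:
`μ{c ↮ v}·(μ{glued block N is j-small} − μ{c is j-small in G + K_N}) ≤ (μ{|π(v)| ≤ j} − μ{|π(c)| ≤ j})·μ{c ↮ N}`.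
Proof: `SignedStar.lemma3_ii_signed` for the monotone cluster property `|C ∩ A| ≥ j+1` with `Q = {c ↮ N}` (so
`D ∩ Q = Q` as `v ∈ N`), then `C(v) ⊆ block` on `{c ↮ N}` and the set algebra of `blockSmall_le_gluedSmall_add`.
[cite: KozmaNitzan2024, Lemma 3(ii) (pp. 6–7), Lemma 5 (p. 13); VandenbergHaggstromKahn2005, Thms. 1.3, 1.5] -/
private theorem blockSmall_signed_local (w : Sym2 (Fin n) → unitInterval) (A N : Finset (Fin n))
    (c v : Fin n) (j : ℕ) (hv : v ∈ N) :
    (prodBernoulli w).real {ω : BondConfig (Fin n) | ¬ (openGraph ω).Reachable c v} *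
        ((prodBernoulli w).real {ω : BondConfig (Fin n) |
            (A.filter fun y => ∃ a ∈ N, ω ∈ openConn a y).card ≤ j} -
          (prodBernoulli w).real {ω : BondConfig (Fin n) |
            ((∃ a ∈ N, ω ∈ openConn c a) ∧ (A.filter fun y => ∃ a ∈ N, ω ∈ openConn a y).card ≤ j) ∨
              ((¬ ∃ a ∈ N, ω ∈ openConn c a) ∧ (A.filter fun y => ω ∈ openConn c y).card ≤ j)}) ≤
      ((prodBernoulli w).real {ω : BondConfig (Fin n) | (A.filter fun y => ω ∈ openConn v y).card ≤ j} -
          (prodBernoulli w).real {ω : BondConfig (Fin n) | (A.filter fun y => ω ∈ openConn c y).card ≤ j}) *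
        (prodBernoulli w).real {ω : BondConfig (Fin n) | ∀ u ∈ (↑N : Set (Fin n)), ¬ (openGraph ω).Reachable c u} := by
  classical
  set μ := prodBernoulli w with hμ
  -- the monotone cluster property `|C ∩ A| ≥ j+1`
  set P : Set (Fin n) → Prop := fun S => j + 1 ≤ (A.filter fun x => x ∈ S).card with hP
  have hPmono : ∀ S T : Set (Fin n), S ⊆ T → P S → P T := by
    intro S T hST hS
    refine le_trans hS (Finset.card_le_card fun x hx => ?_)
    simp only [Finset.mem_filter] at hx ⊢
    exact ⟨hx.1, hST hx.2⟩
  have card_openCluster : ∀ (ω : BondConfig (Fin n)) (a : Fin n),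
      (A.filter fun x => x ∈ openCluster ω a).card = (A.filter fun x => ω ∈ openConn a x).card := by
    intro ω a
    have h : (A.filter fun x => x ∈ openCluster ω a) = (A.filter fun x => ω ∈ openConn a x) :=
      Finset.filter_congr fun x _ => Iff.rfl
    rw [h]
  -- events
  set Sv : Set (BondConfig (Fin n)) := {ω | (A.filter fun y => ω ∈ openConn v y).card ≤ j} with hSv
  set Sc : Set (BondConfig (Fin n)) := {ω | (A.filter fun y => ω ∈ openConn c y).card ≤ j} with hSc
  set Sb : Set (BondConfig (Fin n)) := {ω | (A.filter fun y => ∃ a ∈ N, ω ∈ openConn a y).card ≤ j} with hSb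
  set T : Set (BondConfig (Fin n)) := {ω | ∃ a ∈ N, ω ∈ openConn c a} with hT
  set Sg : Set (BondConfig (Fin n)) := {ω |
      ((∃ a ∈ N, ω ∈ openConn c a) ∧ (A.filter fun y => ∃ a ∈ N, ω ∈ openConn a y).card ≤ j) ∨
        ((¬ ∃ a ∈ N, ω ∈ openConn c a) ∧ (A.filter fun y => ω ∈ openConn c y).card ≤ j)} with hSg
  set D : Set (BondConfig (Fin n)) := {ω | ¬ (openGraph ω).Reachable c v} with hD
  set Q : Set (BondConfig (Fin n)) := {ω | ∀ u ∈ (↑N : Set (Fin n)), ¬ (openGraph ω).Reachable c u} with hQ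
  have hXc : {ω : BondConfig (Fin n) | P (openCluster ω c)} = Scᶜ := by
    ext ω; simp only [hP, hSc, mem_setOf_eq, mem_compl_iff, not_le, card_openCluster]; omega
  have hXv : {ω : BondConfig (Fin n) | P (openCluster ω v)} = Svᶜ := by
    ext ω; simp only [hP, hSv, mem_setOf_eq, mem_compl_iff, not_le, card_openCluster]; omega
  -- `Q ⊆ D` as `v ∈ N`
  have hDQ : D ∩ Q = Q := inter_eq_right.2 fun ω hω => hω v (Finset.mem_coe.2 hv)
  -- the signed Lemma 3(ii) with `Q = {c ↮ N}`
  have L3 : μ.real D * (μ.real (Scᶜ ∩ Q) - μ.real (Svᶜ ∩ Q)) ≤ (μ.real Scᶜ - μ.real Svᶜ) * μ.real Q := by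
    have key := SignedStar.lemma3_ii_signed w c v P hPmono (isLowerSet_disconnFamily c (↑N : Set (Fin n)))
    rw [← setOf_forall_not_reachable_eq, hXc, hXv] at key
    have hDQ' : {ω : BondConfig (Fin n) | ¬ (openGraph ω).Reachable c v} ∩ Q = Q := hDQ
    rw [hDQ'] at key
    exact key
  -- `{c ↮ N} = Tᶜ`
  have hTc : Q = Tᶜ := by
    ext ω
    simp only [hQ, hT, mem_setOf_eq, mem_compl_iff, not_exists, not_and, Finset.mem_coe]
    rfl
  -- `C(v) big ⇒ block big`
  have hvb : Svᶜ ⊆ Sbᶜ := by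
    intro ω hω
    simp only [hSv, hSb, mem_compl_iff, mem_setOf_eq, not_le] at hω ⊢
    refine lt_of_lt_of_le hω (Finset.card_le_card fun y hy => ?_)
    simp only [Finset.mem_filter] at hy ⊢
    exact ⟨hy.1, v, hv, hy.2⟩
  -- `Sgᶜ ⊆ (T ∩ Sbᶜ) ∪ (Scᶜ ∩ Tᶜ)`
  have hSgsub : Sgᶜ ⊆ (T ∩ Sbᶜ) ∪ (Scᶜ ∩ Tᶜ) := by
    intro ω hω
    simp only [hSg, hT, hSb, hSc, mem_compl_iff, mem_setOf_eq, mem_union, mem_inter_iff, not_or, not_and,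
      not_le] at hω ⊢
    by_cases hcT : ∃ a ∈ N, ω ∈ openConn c a
    · exact Or.inl ⟨hcT, hω.1 hcT⟩
    · exact Or.inr ⟨hω.2 hcT, hcT⟩
  have e1 : μ.real (Sbᶜ ∩ T) + μ.real (Sbᶜ \ T) = μ.real Sbᶜ :=
    measureReal_inter_add_sdiff (MeasurableSet.of_discrete : MeasurableSet T) (measure_ne_top _ _)
  have hU : μ.real Sgᶜ ≤ μ.real (T ∩ Sbᶜ) + μ.real (Scᶜ ∩ Tᶜ) :=
    (measureReal_mono hSgsub).trans (measureReal_union_le _ _)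
  have hvbT : μ.real (Svᶜ ∩ Tᶜ) ≤ μ.real (Sbᶜ ∩ Tᶜ) :=
    measureReal_mono fun ω ⟨h1, h2⟩ => ⟨hvb h1, h2⟩
  have hD0 : 0 ≤ μ.real D := measureReal_nonneg
  rw [hTc] at L3
  -- complements to probabilities of the `small` events
  have cSg : μ.real Sgᶜ = 1 - μ.real Sg := probReal_compl_eq_one_sub MeasurableSet.of_discrete
  have cSb : μ.real Sbᶜ = 1 - μ.real Sb := probReal_compl_eq_one_sub MeasurableSet.of_discrete
  have cSc : μ.real Scᶜ = 1 - μ.real Sc := probReal_compl_eq_one_sub MeasurableSet.of_discrete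
  have cSv : μ.real Svᶜ = 1 - μ.real Sv := probReal_compl_eq_one_sub MeasurableSet.of_discrete
  have s4 : μ.real (T ∩ Sbᶜ) + μ.real (Sbᶜ ∩ Tᶜ) = μ.real Sbᶜ := by
    rw [inter_comm T Sbᶜ, ← Set.sdiff_eq, e1]
  have s1 : μ.real D * μ.real Sgᶜ ≤ μ.real D * (μ.real (T ∩ Sbᶜ) + μ.real (Scᶜ ∩ Tᶜ)) :=
    mul_le_mul_of_nonneg_left hU hD0
  have s3 : μ.real D * μ.real (Svᶜ ∩ Tᶜ) ≤ μ.real D * μ.real (Sbᶜ ∩ Tᶜ) :=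
    mul_le_mul_of_nonneg_left hvbT hD0
  have main : μ.real D * μ.real Sgᶜ ≤ μ.real D * μ.real Sbᶜ + (μ.real Scᶜ - μ.real Svᶜ) * μ.real Tᶜ := by
    rw [← s4]
    linarith [s1, L3, s3]
  rw [cSg, cSb, cSc, cSv] at main
  rw [hTc]
  linarith [main]



/-- **Signed glued-block transfer inside `Wᶜ`.**  For relays `A` avoiding `W`, a block `N ⊆ A` with `v ∈ N` and a
relay `c ∈ A`:
`μ{c ↮ v inside Wᶜ}·(μ{port block j-small inside Wᶜ} − μ{c j-small in G[Wᶜ] + K_N}) ≤ (Φ_{Wᶜ}(v) − Φ_{Wᶜ}(c))·μ{c ↮ N inside Wᶜ}`.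
Transport of `blockSmall_signed` (local copy) by `real_inside_eq_real_restrict`.
[cite: KozmaNitzan2024, Lemma 3(ii) (pp. 6–7), Lemma 5 (p. 13)] -/
theorem blockSmall_signed_inside (w : Sym2 (Fin n) → unitInterval) (A W N : Finset (Fin n))
    (c v : Fin n) (j : ℕ) (hAW : ∀ a ∈ A, a ∉ W) (hNA : N ⊆ A) (hv : v ∈ N) (hc : c ∈ A) :
    (prodBernoulli w).real {ω : BondConfig (Fin n) | ω ∉ openConnIn ((↑W : Set (Fin n))ᶜ) c v} *
        ((prodBernoulli w).real {ω : BondConfig (Fin n) |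
            (A.filter fun y => ∃ a ∈ N, ω ∈ openConnIn ((↑W : Set (Fin n))ᶜ) a y).card ≤ j} -
          (prodBernoulli w).real {ω : BondConfig (Fin n) |
            ((∃ a ∈ N, ω ∈ openConnIn ((↑W : Set (Fin n))ᶜ) c a) ∧
                (A.filter fun y => ∃ a ∈ N, ω ∈ openConnIn ((↑W : Set (Fin n))ᶜ) a y).card ≤ j) ∨
              ((¬ ∃ a ∈ N, ω ∈ openConnIn ((↑W : Set (Fin n))ᶜ) c a) ∧
                (A.filter fun y => ω ∈ openConnIn ((↑W : Set (Fin n))ᶜ) c y).card ≤ j)}) ≤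
      ((prodBernoulli w).real {ω : BondConfig (Fin n) |
            (A.filter fun y => ω ∈ openConnIn ((↑W : Set (Fin n))ᶜ) v y).card ≤ j} -
          (prodBernoulli w).real {ω : BondConfig (Fin n) |
            (A.filter fun y => ω ∈ openConnIn ((↑W : Set (Fin n))ᶜ) c y).card ≤ j}) *
        (prodBernoulli w).real {ω : BondConfig (Fin n) | ∀ u ∈ N, ω ∉ openConnIn ((↑W : Set (Fin n))ᶜ) c u} := by
  have hvW : v ∉ W := hAW v (hNA hv)
  have hcW : c ∉ W := hAW c hc
  -- the six events as predicates of the connection relation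
  let ΦS : Fin n → (Fin n → Fin n → Prop) → Prop := fun x r => (A.filter fun y => r x y).card ≤ j
  let ΦB : (Fin n → Fin n → Prop) → Prop := fun r => (A.filter fun y => ∃ a ∈ N, r a y).card ≤ j
  let ΦC : (Fin n → Fin n → Prop) → Prop := fun r =>
    ((∃ a ∈ N, r c a) ∧ (A.filter fun y => ∃ a ∈ N, r a y).card ≤ j) ∨
      ((¬ ∃ a ∈ N, r c a) ∧ (A.filter fun y => r c y).card ≤ j)
  let ΦD : (Fin n → Fin n → Prop) → Prop := fun r => ¬ r c v
  let ΦQ : (Fin n → Fin n → Prop) → Prop := fun r => ∀ u ∈ N, ¬ r c u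
  have hS : ∀ x, x ∉ W → ∀ r r' : Fin n → Fin n → Prop, (∀ a b, a ∉ W → (r a b ↔ r' a b)) →
      (ΦS x r ↔ ΦS x r') := by
    intro x hx r r' h
    have : (A.filter fun y => r x y) = (A.filter fun y => r' x y) :=
      Finset.filter_congr fun y _ => h x y hx
    simp only [ΦS, this]
  have hBset : ∀ r r' : Fin n → Fin n → Prop, (∀ a b, a ∉ W → (r a b ↔ r' a b)) →
      (A.filter fun y => ∃ a ∈ N, r a y) = (A.filter fun y => ∃ a ∈ N, r' a y) := by
    intro r r' h
    exact Finset.filter_congr fun y _ =>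
      ⟨fun ⟨a, ha, hr⟩ => ⟨a, ha, (h a y (hAW a (hNA ha))).1 hr⟩,
        fun ⟨a, ha, hr⟩ => ⟨a, ha, (h a y (hAW a (hNA ha))).2 hr⟩⟩
  have hB : ∀ r r' : Fin n → Fin n → Prop, (∀ a b, a ∉ W → (r a b ↔ r' a b)) → (ΦB r ↔ ΦB r') := by
    intro r r' h
    simp only [ΦB, hBset r r' h]
  have hC : ∀ r r' : Fin n → Fin n → Prop, (∀ a b, a ∉ W → (r a b ↔ r' a b)) → (ΦC r ↔ ΦC r') := by
    intro r r' h
    have hT : (∃ a ∈ N, r c a) ↔ (∃ a ∈ N, r' c a) :=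
      ⟨fun ⟨a, ha, hr⟩ => ⟨a, ha, (h c a hcW).1 hr⟩, fun ⟨a, ha, hr⟩ => ⟨a, ha, (h c a hcW).2 hr⟩⟩
    have hSc : (A.filter fun y => r c y) = (A.filter fun y => r' c y) :=
      Finset.filter_congr fun y _ => h c y hcW
    simp only [ΦC, hT, hBset r r' h, hSc]
  have hD : ∀ r r' : Fin n → Fin n → Prop, (∀ a b, a ∉ W → (r a b ↔ r' a b)) → (ΦD r ↔ ΦD r') := by
    intro r r' h
    simp only [ΦD, h c v hcW]
  have hQ : ∀ r r' : Fin n → Fin n → Prop, (∀ a b, a ∉ W → (r a b ↔ r' a b)) → (ΦQ r ↔ ΦQ r') := by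
    intro r r' h
    exact forall₂_congr fun u _ => by rw [h c u hcW]
  -- transport each of the six probabilities
  have eV := real_inside_eq_real_restrict w W (ΦS v) (hS v hvW)
  have eC := real_inside_eq_real_restrict w W (ΦS c) (hS c hcW)
  have eB := real_inside_eq_real_restrict w W ΦB hB
  have eG := real_inside_eq_real_restrict w W ΦC hC
  have eD := real_inside_eq_real_restrict w W ΦD hD
  have eQ := real_inside_eq_real_restrict w W ΦQ hQ
  simp only [ΦS, ΦB, ΦC, ΦD, ΦQ] at eV eC eB eG eD eQ
  rw [eV, eC, eB, eG, eD, eQ]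
  have key := blockSmall_signed_local (fun e : Sym2 (Fin n) => if (∀ x ∈ e, x ∉ W) then w e else 0) A N c v j hv
  simp only [Finset.mem_coe] at key
  exact key

end LossyPocketT

end Summit.CriticalPhenomena.PercolationContinuityZ3.Theorems

end
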